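import Summits.AtomisticToContinuum.Crystallization.Theorems.PalmUnimodularRigidityLayeredLawsSelectHcpDefs
import Summits.AtomisticToContinuum.Crystallization.Theorems.ExcessDecayLiouvilleCoarseGrainsHcpEnergySeries
import Summits.AtomisticToContinuum.Crystallization.Theorems.ExcessDecayLiouvilleCoarseGrainsPinFromSeries
import Literature.MathematicalPhysics.StatisticalMechanics.HcpSiteGeometry

/-!
# Zero site stress of relaxed hcp, I: summability and the point symmetries
(stub `stub_zeroStress` of line `mtp-prestress-split-ergodic-frame`, crux `LayeredLawsSelectHcp`,
stmt-AtomisticToContinuum-9226)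

The squared-length site stress tensor of `hcp(a, h)` at the root,
`S_lm(a,h) = ∑_{v ≠ 0} W′(‖y_v‖²) (y_v)_l (y_v)_m` (`hcpSiteStress`), `y_v = hcpSite a h v`,
`W′ = ljSqDeriv`, is handled entrywise:

* `‖y_v‖² = a² Q v + k² h²` (`hcpSite_norm_sq`, from `hcp_norm_sq_eq`), whence every entry series
  is dominated by `½ (s⁻³ + s⁻⁶)`, `s = a² Q v + k² h² ≥ min (a², h²)`, and is summable
  (`summable_hcpStressTerm`, from the landed `hcpEnergySeries_of_eq`);
* three index symmetries of `ℤ³` realise isometries of the site set fixing the root: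
  `(k,i,j) ↦ (−k,i,j)` (the mirror `z ↦ −z`), `(k,i,j) ↦ (k,j,i)` (the mirror in the line at
  angle `π/6`) and `(k,i,j) ↦ (k, −i−j−L_k, j)` (the mirror `x ↦ −x`, `L_k ∈ {0,1}` the letter of
  layer `k`); re-indexing the series (`Equiv.tsum_eq`) gives `S₀₁ = S₀₂ = S₁₂ = 0` and
  `S₀₀ = S₁₁` (`stub_zeroStressSymmetry`, a registered sub-goal).

The diagonal (Fermat at a minimiser of `hcpE`) is part II. All `[folklore]`.
-/

noncomputable section

namespace Summit.AtomisticToContinuum.Crystallization.Theorems.PalmUnimodularRigidity.LayeredLawsSelectHcp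

open MeasureTheory Set
open Literature.MathematicalPhysics.StatisticalMechanics Literature.Geometry.DiscreteGeometry
open Summit.AtomisticToContinuum.Crystallization.Theorems.ExcessDecayLiouvilleCoarseGrains
  (hcpEnergySeries_of_eq hcpPinC_Q_nonneg hcpPinC_Q_pos)


/-! ## The index form and the sites -/

/-- `Q ≥ 0`. [folklore] -/
theorem hcpQ_nonneg (v : ℤ × ℤ × ℤ) : 0 ≤ hcpQ v := hcpPinC_Q_nonneg v

/-- `a² Q v + k² h² > 0` for `v ≠ 0`, `a, h ≠ 0`. [folklore] -/
theorem hcpRadicand_pos {a h : ℝ} (ha : a ≠ 0) (hh : h ≠ 0) {v : ℤ × ℤ × ℤ} (hv : v ≠ 0) :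
    0 < a ^ 2 * hcpQ v + (v.1 : ℝ) ^ 2 * h ^ 2 := by
  by_cases hk : v.1 = 0
  · have hQ : 0 < hcpQ v := hcpPinC_Q_pos v hv hk
    have : (v.1 : ℝ) = 0 := by exact_mod_cast hk
    rw [this]
    positivity
  · have hk' : (v.1 : ℝ) ≠ 0 := by exact_mod_cast hk
    have := hcpQ_nonneg v
    positivity

/-- Lower bound `a² Q v + k² h² ≥ min (a²) (h²)` for `v ≠ 0`. [folklore] -/
theorem min_sq_le_hcpRadicand (a h : ℝ) {v : ℤ × ℤ × ℤ} (hv : v ≠ 0) :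
    min (a ^ 2) (h ^ 2) ≤ a ^ 2 * hcpQ v + (v.1 : ℝ) ^ 2 * h ^ 2 := by
  have hQ := hcpQ_nonneg v
  by_cases hk : v.1 = 0
  · have hQ1 : 1 ≤ hcpQ v := by
      obtain ⟨k, i, j⟩ := v
      dsimp only at hk
      subst hk
      have hij : ((i, j) : ℤ × ℤ) ≠ 0 := by
        rintro h0; simp only [Prod.mk_eq_zero] at h0; obtain ⟨rfl, rfl⟩ := h0; exact hv rfl
      have h1 : (1 : ℝ) ≤ (i : ℝ) ^ 2 + (i : ℝ) * j + (j : ℝ) ^ 2 := by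
        exact_mod_cast one_le_sq_add_mul_add_sq hij
      simp only [hcpQ, Even.zero, if_true, add_zero]
      exact h1
    calc min (a ^ 2) (h ^ 2) ≤ a ^ 2 := min_le_left _ _
      _ ≤ a ^ 2 * hcpQ v + (v.1 : ℝ) ^ 2 * h ^ 2 := by nlinarith [sq_nonneg a, sq_nonneg h]
  · have hk1 : (1 : ℝ) ≤ (v.1 : ℝ) ^ 2 := by
      have : (1 : ℤ) ≤ v.1 ^ 2 := by nlinarith [Int.one_le_abs hk, sq_abs v.1]
      exact_mod_cast this
    calc min (a ^ 2) (h ^ 2) ≤ h ^ 2 := min_le_right _ _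
      _ ≤ a ^ 2 * hcpQ v + (v.1 : ℝ) ^ 2 * h ^ 2 := by nlinarith [sq_nonneg a, sq_nonneg h]

/-- First coordinate of an hcp site. [folklore] -/
theorem hcpSite_apply_zero (a h : ℝ) (v : ℤ × ℤ × ℤ) :
    hcpSite a h v 0 = a * (v.2.1 + v.2.2 / 2 + haggLabel alternatingHagg v.1 / 2) := by
  simp [hcpSite]

/-- Second coordinate of an hcp site. [folklore] -/
theorem hcpSite_apply_one (a h : ℝ) (v : ℤ × ℤ × ℤ) :
    hcpSite a h v 1 = a * √3 / 2 * (v.2.2 + haggLabel alternatingHagg v.1 / 3) := by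
  simp [hcpSite]

/-- Third coordinate of an hcp site. [folklore] -/
theorem hcpSite_apply_two (a h : ℝ) (v : ℤ × ℤ × ℤ) : hcpSite a h v 2 = v.1 * h := by
  simp [hcpSite]

/-- `‖x‖² = x₀² + x₁² + x₂²` in `ℝ³`. [folklore] -/
theorem norm_sq_eq_three (x : EuclideanSpace ℝ (Fin 3)) : ‖x‖ ^ 2 = x 0 ^ 2 + x 1 ^ 2 + x 2 ^ 2 := by
  rw [EuclideanSpace.norm_sq_eq, Fin.sum_univ_three]
  simp [sq_abs]

/-- **`‖y_v‖² = a² Q v + k² h²`.** [folklore] -/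
theorem hcpSite_norm_sq (a h : ℝ) (v : ℤ × ℤ × ℤ) :
    ‖hcpSite a h v‖ ^ 2 = a ^ 2 * hcpQ v + (v.1 : ℝ) ^ 2 * h ^ 2 := by
  unfold hcpSite hcpQ
  rw [hcp_norm_sq_eq, haggLabel_alternating]
  split_ifs <;> push_cast <;> ring

/-- The root is `hcpSite a h 0 = 0`; no other index gives `0` when `a, h ≠ 0`. Here only:
`hcpSite a h 0 = 0`. [folklore] -/
theorem hcpSite_zero (a h : ℝ) : hcpSite a h 0 = 0 := barlowPos_alternating_zero a h

/-! ## Summability of the entry series -/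

/-- `|W′(s)| s ≤ ½ (s⁻³ + s⁻⁶)` for `s > 0`. [folklore] -/
theorem abs_ljSqDeriv_mul_le {s : ℝ} (hs : 0 < s) :
    |ljSqDeriv s| * s ≤ (1 / 2) * ((s⁻¹) ^ 3 + (s⁻¹) ^ 6) := by
  have h4 : (s⁻¹) ^ 4 * s = (s⁻¹) ^ 3 := by field_simp
  have h7 : (s⁻¹) ^ 7 * s = (s⁻¹) ^ 6 := by field_simp
  have hi : 0 ≤ s⁻¹ := inv_nonneg.2 hs.le
  unfold ljSqDeriv
  rw [abs_mul, abs_of_nonneg (by norm_num : (0 : ℝ) ≤ 1 / 2), mul_assoc]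
  gcongr
  calc |(s⁻¹) ^ 4 - (s⁻¹) ^ 7| * s ≤ ((s⁻¹) ^ 4 + (s⁻¹) ^ 7) * s := by
        gcongr
        exact abs_sub _ _ |>.trans (by rw [abs_of_nonneg (by positivity),
          abs_of_nonneg (by positivity)])
    _ = (s⁻¹) ^ 3 + (s⁻¹) ^ 6 := by rw [add_mul, h4, h7]

/-- The dominating series `[v ≠ 0] (a² Q v + k² h²)⁻³` is summable. [folklore] -/
theorem summable_hcpRadicand_inv_pow_three {a h : ℝ} (ha : a ≠ 0) (hh : h ≠ 0) :
    Summable fun v : ℤ × ℤ × ℤ =>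
      if v = 0 then (0 : ℝ) else ((a ^ 2 * hcpQ v + (v.1 : ℝ) ^ 2 * h ^ 2)⁻¹) ^ 3 :=
  (hcpEnergySeries_of_eq a h ha hh hcpQ rfl).1

/-- The series `[v ≠ 0] (a² Q v + k² h²)⁻⁶` is summable. [folklore] -/
theorem summable_hcpRadicand_inv_pow_six {a h : ℝ} (ha : a ≠ 0) (hh : h ≠ 0) :
    Summable fun v : ℤ × ℤ × ℤ =>
      if v = 0 then (0 : ℝ) else ((a ^ 2 * hcpQ v + (v.1 : ℝ) ^ 2 * h ^ 2)⁻¹) ^ 6 := by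
  have hm : 0 < min (a ^ 2) (h ^ 2) := lt_min (by positivity) (by positivity)
  refine Summable.of_nonneg_of_le (fun v => ?_) (fun v => ?_)
    ((summable_hcpRadicand_inv_pow_three ha hh).mul_left (((min (a ^ 2) (h ^ 2))⁻¹) ^ 3))
  · split_ifs with hv
    · exact le_rfl
    · exact pow_nonneg (inv_nonneg.2 (hcpRadicand_pos ha hh hv).le) _
  · split_ifs with hv
    · simp
    · have hp := hcpRadicand_pos ha hh hv
      have hle : (a ^ 2 * hcpQ v + (v.1 : ℝ) ^ 2 * h ^ 2)⁻¹ ≤ (min (a ^ 2) (h ^ 2))⁻¹ :=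
        (inv_le_inv₀ hp hm).2 (min_sq_le_hcpRadicand a h hv)
      have h0 : 0 ≤ (a ^ 2 * hcpQ v + (v.1 : ℝ) ^ 2 * h ^ 2)⁻¹ := inv_nonneg.2 hp.le
      calc ((a ^ 2 * hcpQ v + (v.1 : ℝ) ^ 2 * h ^ 2)⁻¹) ^ 6
          = ((a ^ 2 * hcpQ v + (v.1 : ℝ) ^ 2 * h ^ 2)⁻¹) ^ 3 *
              ((a ^ 2 * hcpQ v + (v.1 : ℝ) ^ 2 * h ^ 2)⁻¹) ^ 3 := by ring
        _ ≤ ((min (a ^ 2) (h ^ 2))⁻¹) ^ 3 * ((a ^ 2 * hcpQ v + (v.1 : ℝ) ^ 2 * h ^ 2)⁻¹) ^ 3 := by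
              gcongr

/-- Pointwise bound `|[v≠0] W′(‖y‖²) y_l y_m| ≤ ½ ([v≠0] s⁻³ + [v≠0] s⁻⁶)`. [folklore] -/
theorem norm_hcpStressTerm_le {a h : ℝ} (ha : a ≠ 0) (hh : h ≠ 0) (l m : Fin 3)
    (v : ℤ × ℤ × ℤ) :
    ‖(if v = 0 then (0 : ℝ) else
        ljSqDeriv (‖hcpSite a h v‖ ^ 2) * (hcpSite a h v l * hcpSite a h v m))‖ ≤ (1 / 2) *
      ((if v = 0 then (0 : ℝ) else ((a ^ 2 * hcpQ v + (v.1 : ℝ) ^ 2 * h ^ 2)⁻¹) ^ 3) +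
       (if v = 0 then (0 : ℝ) else ((a ^ 2 * hcpQ v + (v.1 : ℝ) ^ 2 * h ^ 2)⁻¹) ^ 6)) := by
  split_ifs with hv
  · simp
  · have hp := hcpRadicand_pos ha hh hv
    rw [Real.norm_eq_abs, abs_mul, abs_mul]
    have h0 : |hcpSite a h v l| ≤ ‖hcpSite a h v‖ := by
      simpa [Real.norm_eq_abs] using PiLp.norm_apply_le (hcpSite a h v) l
    have h1 : |hcpSite a h v m| ≤ ‖hcpSite a h v‖ := by
      simpa [Real.norm_eq_abs] using PiLp.norm_apply_le (hcpSite a h v) m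
    calc |ljSqDeriv (‖hcpSite a h v‖ ^ 2)| * (|hcpSite a h v l| * |hcpSite a h v m|)
        ≤ |ljSqDeriv (‖hcpSite a h v‖ ^ 2)| * (‖hcpSite a h v‖ * ‖hcpSite a h v‖) := by
          gcongr
      _ = |ljSqDeriv (‖hcpSite a h v‖ ^ 2)| * ‖hcpSite a h v‖ ^ 2 := by ring
      _ ≤ _ := by
          rw [hcpSite_norm_sq]
          exact abs_ljSqDeriv_mul_le hp

/-- **Every entry series of the stress tensor is summable** (`a, h ≠ 0`). [folklore] -/
theorem summable_hcpStressTerm {a h : ℝ} (ha : a ≠ 0) (hh : h ≠ 0) (l m : Fin 3) :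
    Summable fun v : ℤ × ℤ × ℤ => if v = 0 then (0 : ℝ) else
      ljSqDeriv (‖hcpSite a h v‖ ^ 2) * (hcpSite a h v l * hcpSite a h v m) :=
  Summable.of_norm_bounded
    (((summable_hcpRadicand_inv_pow_three ha hh).add
      (summable_hcpRadicand_inv_pow_six ha hh)).mul_left (1 / 2))
    (norm_hcpStressTerm_le ha hh l m)

/-! ## Re-indexing by an index symmetry -/

/-- **Re-indexing the stress series** by an involution `σ` of `ℤ³` fixing `0` and preserving the
site norms: `S_lm = ∑' [v ≠ 0] W′(‖y_v‖²) (y_{σ v})_l (y_{σ v})_m`. [folklore] -/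
theorem hcpSiteStress_reindex (a h : ℝ) {σ : ℤ × ℤ × ℤ → ℤ × ℤ × ℤ}
    (hσ : Function.Involutive σ) (h0 : σ 0 = 0)
    (hn : ∀ v, ‖hcpSite a h (σ v)‖ ^ 2 = ‖hcpSite a h v‖ ^ 2) (l m : Fin 3) :
    hcpSiteStress a h l m = ∑' v : ℤ × ℤ × ℤ, if v = 0 then (0 : ℝ) else
      ljSqDeriv (‖hcpSite a h v‖ ^ 2) * (hcpSite a h (σ v) l * hcpSite a h (σ v) m) := by
  unfold hcpSiteStress
  rw [← Equiv.tsum_eq (hσ.toPerm σ)]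
  refine tsum_congr fun v => ?_
  have hiff : σ v = 0 ↔ v = 0 :=
    ⟨fun hv => hσ.injective (hv.trans h0.symm), by rintro rfl; exact h0⟩
  simp only [Function.Involutive.coe_toPerm, hiff, hn]

/-- If moreover `(y_{σ v})_l (y_{σ v})_m = −(y_v)_l (y_v)_m` for all `v`, then `S_lm = 0`. [folklore] -/
theorem hcpSiteStress_eq_zero_of_mirror (a h : ℝ) {σ : ℤ × ℤ × ℤ → ℤ × ℤ × ℤ}
    (hσ : Function.Involutive σ) (h0 : σ 0 = 0)
    (hn : ∀ v, ‖hcpSite a h (σ v)‖ ^ 2 = ‖hcpSite a h v‖ ^ 2) {l m : Fin 3}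
    (hlm : ∀ v, hcpSite a h (σ v) l * hcpSite a h (σ v) m = -(hcpSite a h v l * hcpSite a h v m)) :
    hcpSiteStress a h l m = 0 := by
  have key := hcpSiteStress_reindex a h hσ h0 hn l m
  have hneg : (∑' v : ℤ × ℤ × ℤ, if v = 0 then (0 : ℝ) else
      ljSqDeriv (‖hcpSite a h v‖ ^ 2) * (hcpSite a h (σ v) l * hcpSite a h (σ v) m)) =
      -hcpSiteStress a h l m := by
    unfold hcpSiteStress
    rw [← tsum_neg]
    refine tsum_congr fun v => ?_
    split_ifs
    · simp
    · rw [hlm]; ring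
  linarith

/-! ## The three mirrors -/

/-- The letters are even in the layer index: `L (−k) = L k`. [folklore] -/
theorem haggLabel_alternating_neg (k : ℤ) :
    haggLabel alternatingHagg (-k) = haggLabel alternatingHagg k := by
  rw [haggLabel_alternating, haggLabel_alternating]
  exact if_congr even_neg rfl rfl

/-- **The mirror `z ↦ −z`** on indices, `(k,i,j) ↦ (−k,i,j)`: an involution fixing `0`, acting on
the sites by `(y₀, y₁, y₂) ↦ (y₀, y₁, −y₂)`, hence norm-preserving. [folklore] -/
theorem hcpMirrorZ_spec (a h : ℝ) :
    Function.Involutive (fun v : ℤ × ℤ × ℤ => (-v.1, v.2.1, v.2.2)) ∧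
    (fun v : ℤ × ℤ × ℤ => (-v.1, v.2.1, v.2.2)) 0 = 0 ∧
    (∀ v : ℤ × ℤ × ℤ, hcpSite a h (-v.1, v.2.1, v.2.2) 0 = hcpSite a h v 0 ∧
      hcpSite a h (-v.1, v.2.1, v.2.2) 1 = hcpSite a h v 1 ∧
      hcpSite a h (-v.1, v.2.1, v.2.2) 2 = -hcpSite a h v 2) ∧
    (∀ v : ℤ × ℤ × ℤ, ‖hcpSite a h (-v.1, v.2.1, v.2.2)‖ ^ 2 = ‖hcpSite a h v‖ ^ 2) := by
  have hc : ∀ v : ℤ × ℤ × ℤ, hcpSite a h (-v.1, v.2.1, v.2.2) 0 = hcpSite a h v 0 ∧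
      hcpSite a h (-v.1, v.2.1, v.2.2) 1 = hcpSite a h v 1 ∧
      hcpSite a h (-v.1, v.2.1, v.2.2) 2 = -hcpSite a h v 2 := fun v => by
    simp only [hcpSite_apply_zero, hcpSite_apply_one, hcpSite_apply_two,
      haggLabel_alternating_neg]
    push_cast
    exact ⟨trivial, trivial, by ring⟩
  refine ⟨fun v => by simp, by simp, hc, fun v => ?_⟩
  obtain ⟨e0, e1, e2⟩ := hc v
  rw [norm_sq_eq_three, norm_sq_eq_three, e0, e1, e2]
  ring

/-- **The mirror in the line at angle `π/6`** on indices, `(k,i,j) ↦ (k,j,i)`: an involution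
fixing `0`, acting on the sites by `(y₀, y₁, y₂) ↦ (y₀/2 + (√3/2) y₁, (√3/2) y₀ − y₁/2, y₂)`,
hence norm-preserving. [folklore] -/
theorem hcpMirrorD_spec (a h : ℝ) :
    Function.Involutive (fun v : ℤ × ℤ × ℤ => (v.1, v.2.2, v.2.1)) ∧
    (fun v : ℤ × ℤ × ℤ => (v.1, v.2.2, v.2.1)) 0 = 0 ∧
    (∀ v : ℤ × ℤ × ℤ,
      hcpSite a h (v.1, v.2.2, v.2.1) 0 = hcpSite a h v 0 / 2 + √3 / 2 * hcpSite a h v 1 ∧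
      hcpSite a h (v.1, v.2.2, v.2.1) 1 = √3 / 2 * hcpSite a h v 0 - hcpSite a h v 1 / 2 ∧
      hcpSite a h (v.1, v.2.2, v.2.1) 2 = hcpSite a h v 2) ∧
    (∀ v : ℤ × ℤ × ℤ, ‖hcpSite a h (v.1, v.2.2, v.2.1)‖ ^ 2 = ‖hcpSite a h v‖ ^ 2) := by
  have h3 : (√3 : ℝ) ^ 2 = 3 := Real.sq_sqrt (by norm_num)
  have hc : ∀ v : ℤ × ℤ × ℤ,
      hcpSite a h (v.1, v.2.2, v.2.1) 0 = hcpSite a h v 0 / 2 + √3 / 2 * hcpSite a h v 1 ∧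
      hcpSite a h (v.1, v.2.2, v.2.1) 1 = √3 / 2 * hcpSite a h v 0 - hcpSite a h v 1 / 2 ∧
      hcpSite a h (v.1, v.2.2, v.2.1) 2 = hcpSite a h v 2 := fun v => by
    simp only [hcpSite_apply_zero, hcpSite_apply_one, hcpSite_apply_two]
    refine ⟨?_, ?_, trivial⟩
    · linear_combination (-(a * (v.2.2 + haggLabel alternatingHagg v.1 / 3)) / 4) * h3
    · ring
  refine ⟨fun v => by simp, by simp, hc, fun v => ?_⟩
  obtain ⟨e0, e1, e2⟩ := hc v
  rw [norm_sq_eq_three, norm_sq_eq_three, e0, e1, e2]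
  linear_combination ((hcpSite a h v 0) ^ 2 / 4 + (hcpSite a h v 1) ^ 2 / 4) * h3

/-- **The mirror `x ↦ −x`** on indices, `(k,i,j) ↦ (k, −i−j−L_k, j)` (`L_k ∈ {0,1}` the letter of
layer `k`): an involution fixing `0`, acting on the sites by `(y₀, y₁, y₂) ↦ (−y₀, y₁, y₂)`, hence
norm-preserving. [folklore] -/
theorem hcpMirrorX_spec (a h : ℝ) :
    Function.Involutive (fun v : ℤ × ℤ × ℤ =>
      (v.1, -v.2.1 - v.2.2 - haggLabel alternatingHagg v.1, v.2.2)) ∧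
    (fun v : ℤ × ℤ × ℤ => (v.1, -v.2.1 - v.2.2 - haggLabel alternatingHagg v.1, v.2.2)) 0 = 0 ∧
    (∀ v : ℤ × ℤ × ℤ,
      hcpSite a h (v.1, -v.2.1 - v.2.2 - haggLabel alternatingHagg v.1, v.2.2) 0 =
          -hcpSite a h v 0 ∧
        hcpSite a h (v.1, -v.2.1 - v.2.2 - haggLabel alternatingHagg v.1, v.2.2) 1 =
          hcpSite a h v 1 ∧
        hcpSite a h (v.1, -v.2.1 - v.2.2 - haggLabel alternatingHagg v.1, v.2.2) 2 =
          hcpSite a h v 2) ∧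
    (∀ v : ℤ × ℤ × ℤ,
      ‖hcpSite a h (v.1, -v.2.1 - v.2.2 - haggLabel alternatingHagg v.1, v.2.2)‖ ^ 2 =
        ‖hcpSite a h v‖ ^ 2) := by
  have hc : ∀ v : ℤ × ℤ × ℤ,
      hcpSite a h (v.1, -v.2.1 - v.2.2 - haggLabel alternatingHagg v.1, v.2.2) 0 =
          -hcpSite a h v 0 ∧
        hcpSite a h (v.1, -v.2.1 - v.2.2 - haggLabel alternatingHagg v.1, v.2.2) 1 =
          hcpSite a h v 1 ∧
        hcpSite a h (v.1, -v.2.1 - v.2.2 - haggLabel alternatingHagg v.1, v.2.2) 2 =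
          hcpSite a h v 2 := fun v => by
    simp only [hcpSite_apply_zero, hcpSite_apply_one, hcpSite_apply_two]
    push_cast
    exact ⟨by ring, trivial, trivial⟩
  refine ⟨fun v => ?_, by simp, hc, fun v => ?_⟩
  · obtain ⟨k, i, j⟩ := v
    refine Prod.ext rfl (Prod.ext ?_ rfl)
    dsimp only
    ring
  · obtain ⟨e0, e1, e2⟩ := hc v
    rw [norm_sq_eq_three, norm_sq_eq_three, e0, e1, e2]
    ring

/-! ## Off-diagonal entries vanish; `S₀₀ = S₁₁` -/

/-- `S₀₁ = 0` and `S₀₂ = 0` (the mirror `x ↦ −x`), `S₁₂ = 0` (the mirror `z ↦ −z`). [folklore] -/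
theorem hcpSiteStress_offDiag (a h : ℝ) :
    hcpSiteStress a h 0 1 = 0 ∧ hcpSiteStress a h 0 2 = 0 ∧ hcpSiteStress a h 1 2 = 0 := by
  obtain ⟨hZi, hZ0, hZc, hZn⟩ := hcpMirrorZ_spec a h
  obtain ⟨hXi, hX0, hXc, hXn⟩ := hcpMirrorX_spec a h
  refine ⟨hcpSiteStress_eq_zero_of_mirror a h hXi hX0 hXn fun v => ?_,
    hcpSiteStress_eq_zero_of_mirror a h hXi hX0 hXn fun v => ?_,
    hcpSiteStress_eq_zero_of_mirror a h hZi hZ0 hZn fun v => ?_⟩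
  · obtain ⟨e0, e1, -⟩ := hXc v
    rw [e0, e1]; ring
  · obtain ⟨e0, -, e2⟩ := hXc v
    rw [e0, e2]; ring
  · obtain ⟨-, e1, e2⟩ := hZc v
    rw [e1, e2]; ring

/-- The stress tensor is symmetric. [folklore] -/
theorem hcpSiteStress_symm (a h : ℝ) (l m : Fin 3) :
    hcpSiteStress a h l m = hcpSiteStress a h m l := by
  unfold hcpSiteStress
  exact tsum_congr fun v => by rw [mul_comm (hcpSite a h v l)]

/-- **`S₀₀ = S₁₁`** (the `π/6` mirror applied to the entry `(0,1)`, using `S₀₁ = 0` and the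
summability of the entry series; `a, h ≠ 0`). [folklore] -/
theorem hcpSiteStress_zero_zero_eq_one_one {a h : ℝ} (ha : a ≠ 0) (hh : h ≠ 0) :
    hcpSiteStress a h 0 0 = hcpSiteStress a h 1 1 := by
  obtain ⟨hDi, hD0, hDc, hDn⟩ := hcpMirrorD_spec a h
  have key := hcpSiteStress_reindex a h hDi hD0 hDn 0 1
  have h01 := (hcpSiteStress_offDiag a h).1
  have hterm : ∀ v : ℤ × ℤ × ℤ, (if v = 0 then (0 : ℝ) else
      ljSqDeriv (‖hcpSite a h v‖ ^ 2) *
        (hcpSite a h (v.1, v.2.2, v.2.1) 0 * hcpSite a h (v.1, v.2.2, v.2.1) 1)) =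
      √3 / 4 * (if v = 0 then (0 : ℝ) else
          ljSqDeriv (‖hcpSite a h v‖ ^ 2) * (hcpSite a h v 0 * hcpSite a h v 0)) -
        √3 / 4 * (if v = 0 then (0 : ℝ) else
          ljSqDeriv (‖hcpSite a h v‖ ^ 2) * (hcpSite a h v 1 * hcpSite a h v 1)) +
        1 / 2 * (if v = 0 then (0 : ℝ) else
          ljSqDeriv (‖hcpSite a h v‖ ^ 2) * (hcpSite a h v 0 * hcpSite a h v 1)) := by
    intro v
    have h3 : (√3 : ℝ) ^ 2 = 3 := Real.sq_sqrt (by norm_num)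
    split_ifs
    · simp
    · obtain ⟨e0, e1, -⟩ := hDc v
      rw [e0, e1]
      linear_combination (ljSqDeriv (‖hcpSite a h v‖ ^ 2) *
        (hcpSite a h v 0 * hcpSite a h v 1) / 4) * h3
  rw [tsum_congr hterm, h01] at key
  have hs00 := summable_hcpStressTerm ha hh 0 0
  have hs11 := summable_hcpStressTerm ha hh 1 1
  have hs01 := summable_hcpStressTerm ha hh 0 1
  rw [((hs00.mul_left _).sub (hs11.mul_left _)).tsum_add (hs01.mul_left _),
    (hs00.mul_left _).tsum_sub (hs11.mul_left _), tsum_mul_left, tsum_mul_left, tsum_mul_left]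
    at key
  have e01 : (∑' v : ℤ × ℤ × ℤ, if v = 0 then (0 : ℝ) else
      ljSqDeriv (‖hcpSite a h v‖ ^ 2) * (hcpSite a h v 0 * hcpSite a h v 1)) = 0 := h01
  have e00 : (∑' v : ℤ × ℤ × ℤ, if v = 0 then (0 : ℝ) else
      ljSqDeriv (‖hcpSite a h v‖ ^ 2) * (hcpSite a h v 0 * hcpSite a h v 0)) =
      hcpSiteStress a h 0 0 := rfl
  have e11 : (∑' v : ℤ × ℤ × ℤ, if v = 0 then (0 : ℝ) else
      ljSqDeriv (‖hcpSite a h v‖ ^ 2) * (hcpSite a h v 1 * hcpSite a h v 1)) =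
      hcpSiteStress a h 1 1 := rfl
  rw [e01, e00, e11] at key
  have h3pos : (0 : ℝ) < √3 := by positivity
  nlinarith [key, h3pos]

/-- **Registered sub-goal `stub_zeroStressSymmetry` of `stub_zeroStress`**: the point symmetries
of hcp at the root kill the off-diagonal entries of the site stress tensor and equalise the two
in-plane diagonal entries; the tensor is symmetric. [folklore] -/
theorem stub_zeroStressSymmetry : ∀ a h : ℝ, a ≠ 0 → h ≠ 0 →
    hcpSiteStress a h 0 1 = 0 ∧ hcpSiteStress a h 0 2 = 0 ∧ hcpSiteStress a h 1 2 = 0 ∧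
    hcpSiteStress a h 0 0 = hcpSiteStress a h 1 1 ∧
    ∀ l m : Fin 3, hcpSiteStress a h l m = hcpSiteStress a h m l :=
  fun a h ha hh => ⟨(hcpSiteStress_offDiag a h).1, (hcpSiteStress_offDiag a h).2.1,
    (hcpSiteStress_offDiag a h).2.2, hcpSiteStress_zero_zero_eq_one_one ha hh,
    hcpSiteStress_symm a h⟩

end Summit.AtomisticToContinuum.Crystallization.Theorems.PalmUnimodularRigidity.LayeredLawsSelectHcp

end
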